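import Summits.AtomisticToContinuum.FouriersLaw.Theses.LocalOhmBV
import Summits.AtomisticToContinuum.FouriersLaw.Theses.TransferKernelPositivity

/-!
# Stub `stub_profileBound` of line `registered` (crux `LocalOhmBV.BVProfile`, item stmt-AtomisticToContinuum-12012)
from thermal passivity (`TransferKernelPositivity.Passivity`, item stmt-AtomisticToContinuum-12010)

The stub asks, for `pinnedChain ω₂ lam β γ` (all `> 0`), under weak-NESS uniqueness and along any steady-state
family, for every `T > 0`, for an `N`-UNIFORM constant `B` with `|t| ≤ B` for every `N`, every site `i : Fin N` and
every limit `t` of the kinetic-temperature response difference quotient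
`δ ↦ (μ_{N,T+δ/2,T−δ/2}(p_i²) − μ_{N,T,T}(p_i²))/δ` along `𝓝[≠] 0`.

The vetted sister crux `Passivity` (stmt-12010) is the same statement with the sharp constant `1/2` (the response
profile lies between the bath responses `±1/2`), under the identical hypothesis prefix; so `Passivity` gives the stub
with `B := 1/2`. This file records that reduction (`stub_profileBound_of_passivity`): the stub is closed modulo
item stmt-12010. No definitions, no named facts; standard axioms.
-/

noncomputable section

open MeasureTheory Filter Topology Set

namespace Summit.AtomisticToContinuum.FouriersLaw.Theorems

/-- **`Passivity` (stmt-AtomisticToContinuum-12010) implies stub `stub_profileBound` of crux `BVProfile`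
(stmt-AtomisticToContinuum-12012), with `B = 1/2`.** Under weak-NESS uniqueness, along any steady-state family of
`pinnedChain ω₂ lam β γ` (all `> 0`) and for every `T > 0`: if every limit `t` of the profile difference quotient
at every site satisfies `|t| ≤ 1/2` (thermal passivity), then there is an `N`-uniform `B` (namely `1/2`) with
`|t| ≤ B` for all `N`, `i`, `t`. Pure logic: instantiate the hypothesis prefix and take `B := 1/2`. -/
theorem stub_profileBound_of_passivity :
    Summit.AtomisticToContinuum.FouriersLaw.Theses.TransferKernelPositivity.Passivity → ∀ ω₂ lam β γ : ℝ, 0 < ω₂ → 0 < lam → 0 < β → 0 < γ → (∀ (N : ℕ) (T_L T_R : ℝ), 0 < T_L → 0 < T_R → ∀ μ ν : MeasureTheory.Measure (Literature.MathematicalPhysics.KineticTheory.HeatConduction.PhaseSpace N), (Literature.MathematicalPhysics.KineticTheory.HeatConduction.pinnedChain ω₂ lam β γ).IsSteadyState N T_L T_R μ → (Literature.MathematicalPhysics.KineticTheory.HeatConduction.pinnedChain ω₂ lam β γ).IsSteadyState N T_L T_R ν → μ = ν) → ∀ μ : (N : ℕ) → ℝ → ℝ → MeasureTheory.Measure (Literature.MathematicalPhysics.KineticTheory.HeatConduction.PhaseSpace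 N), (∀ (N : ℕ) (T_L T_R : ℝ), 0 < T_L → 0 < T_R → (Literature.MathematicalPhysics.KineticTheory.HeatConduction.pinnedChain ω₂ lam β γ).IsSteadyState N T_L T_R (μ N T_L T_R)) → ∀ T : ℝ, 0 < T → ∃ B : ℝ, ∀ (N : ℕ) (i : Fin N) (t : ℝ), Filter.Tendsto (fun δ : ℝ => ((∫ x, (x.2 i) ^ 2 ∂(μ N (T + δ / 2) (T - δ / 2))) - ∫ x, (x.2 i) ^ 2 ∂(μ N T T)) / δ) (nhdsWithin 0 {(0 : ℝ)}ᶜ) (nhds t) → |t| ≤ B := by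
  intro hP ω₂ lam β γ hω hl hβ hγ huniq μ hμ T hT
  exact ⟨1 / 2, fun N i t ht => hP ω₂ lam β γ hω hl hβ hγ huniq μ hμ T hT N i t ht⟩

end Summit.AtomisticToContinuum.FouriersLaw.Theorems

end
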